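import Summits.ResolutionOfSingularities.ResolutionOfSingularities.Theorems.MarkedTransferCampaignW23KangarooClause
import Summits.ResolutionOfSingularities.ResolutionOfSingularities.Theorems.MarkedTransferCampaignW23TailInMSquareProof
import Mathlib.RingTheory.MvPolynomial.Ideal
import Mathlib.Algebra.CharP.Lemmas
import HarnessLib

/-!
# [OURS · L1 W2.3] The kangaroo clause for flag tails — PROOFS of the five closed statements of
# `Theorems/MarkedTransferCampaignW23KangarooClause.lean`

HONEST FRAMING. Everything below is OURS (cell `res-hironaka`, run/shared/lean/pub/res-hironaka/, rung L of
LADDER-RESOLUTION, RESCUE-SEED slot W2.3 «TAILS WITHOUT H♭»; seat `res-L1-s23-pv-1`) or elementary algebra; NOTHING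
here is a statement of H. Hironaka's manuscript *Resolution of singularities in positive characteristics* (2017-03-23,
[Hironaka2017]) and nothing asserts that any statement of that manuscript holds. The manuscript's objects enter ONLY
through the typed carriers of rung S (rows 098/099) via the OURS vocabulary of slot W2.3 (p461945, p464759, p466324) and
the statement file `…CampaignW23KangarooClause.lean`; Hauser's kangaroo specimen through the barrier file
`Literature/Barriers/ResolutionOfSingularities/KangarooShadeIncrease.lean`. AI review is weaker than expert review.

CONTENTS (all OURS; decl names under `…Theorems.CampaignW23.`):
* §A: `mem_flagTails_iff_of_e_eq_one` ⇒ `flagTailsLevelOne_holds : FlagTailsLevelOne p`; `flagTails_add` ⇒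
  `tailTranslationClosed_holds : TailTranslationClosed p`; `pow_sub_mem_of_flagDescent` (two descents agreeing at
  level `1` have tails differing by a `p`-th root of a level-1 knock-out); `tailInMSquareTranslate_holds :
  TailInMSquareTranslate p` (from `tailInMSquare_holds`, p466324).
* §B (`p = 2`, the kangaroo point model `K3`): the explicit forms `F = z⁶(y⁵+y⁴+y³+y²)`, `s = z³y`, the memberships
  `F ∈ max_ξ⁸`, `F ∉ max_ξ⁹`, `s ∈ max_ξ⁴`, `F + s² = z⁶(y⁵+y⁴+y³) ∈ max_ξ⁹`, the two flag tails `x` and `x + s`, and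
  `kangarooPointTails_holds : KangarooPointTails`, `flagDoesNotSelectOrder_holds : FlagDoesNotSelectOrder`; plus the
  residual orders `2` and `3` of the two knock-outs READ OFF the barrier file (`K3.residualOrder_persistent`,
  `K3.residualOrder_rechosen`, citing `residualOrder_along_transform`, `ordZero_kangarooGraph`,
  `Hauser2003_kangarooShadeIncrease` — proved there, instantiated at `K = 𝔽₂` here, not restated).

## References
* `Theorems/MarkedTransferCampaignW23KangarooClause.lean` (statements; this seat), `…TailInMSquare.lean` (p461945),
  `…FlagDescentBookkeeping.lean` (p464759), `…TailInMSquareProof.lean` (p466324);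
  `Literature/Barriers/ResolutionOfSingularities/KangarooShadeIncrease.lean`. [Hauser2003] [Hauser2010]
* H. Hironaka, ms. 2017-03-23: Th. 9.18 p.55; §16.4 Def. 16.15/16.16 p.88 — scope only, not cited as fact. [Hironaka2017]
-/

set_option linter.dupNamespace false -- mandated namespace of this single-conjunct summit

namespace Summit.ResolutionOfSingularities.ResolutionOfSingularities.Theorems

namespace CampaignW23

open Literature.AlgebraicGeometry.Hironaka2017.S16Proof
open Literature.AlgebraicGeometry.Resolution
open IsLocalRing

universe u

/-! ## §A — over an arbitrary §16.4 bundle -/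

section General

variable {p : ℕ} [Fact p.Prime] {O : Type u} [CommRing O] [CharP O p] {ℓ : ℕ}

/-- [OURS · L1 W2.3] At `e = 1` the flag tails of `g` are exactly the `t` with `g − t^p` in the level-1 bracketed
module (universe-polymorphic form of `FlagTailsLevelOne`). [folklore] -/
theorem mem_flagTails_iff_of_e_eq_one (I : InductionInput p O ℓ) (he : I.e = 1) (g t : O) :
    t ∈ flagTails I g ↔ g - t ^ p ∈ forgetDegrees p O ℓ (I.negaSum 1) := by
  constructor
  · rintro ⟨c, hce, hdesc, hc0⟩
    have h := hdesc 1 le_rfl (by omega)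
    rw [he] at hce
    rw [Nat.sub_self, hce, hc0] at h
    exact h
  · intro h
    refine ⟨fun k => if k = 0 then t else g, ?_, ?_, ?_⟩
    · rw [he]
      show g = g
      rfl
    · intro k hk1 hke
      rw [he] at hke
      have hk : k = 1 := le_antisymm hke hk1
      subst hk
      show g - t ^ p ∈ _
      exact h
    · show t = t
      rfl

/-- [OURS · L1 W2.3] `FlagTailsLevelOne p` HOLDS for every prime `p`. [folklore] -/
theorem flagTailsLevelOne_holds (p : ℕ) [Fact p.Prime] : FlagTailsLevelOne p :=
  fun _ _ _ _ I he g t => mem_flagTails_iff_of_e_eq_one I he g t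

/-- [OURS · L1 W2.3] THE TAIL CLASS IS CLOSED UNDER TRANSLATION (universe-polymorphic form of
`TailTranslationClosed`): if `t` is a flag tail of `g` (`e ≥ 1`) and `s^p` is a level-1 knock-out, then `t + s` is
a flag tail of `g` — change the descent at level `0` only; `(t + s)^p = t^p + s^p`. [folklore] -/
theorem flagTails_add (I : InductionInput p O ℓ) (he : 1 ≤ I.e) {g t s : O} (ht : t ∈ flagTails I g)
    (hs : s ^ p ∈ forgetDegrees p O ℓ (I.negaSum 1)) : t + s ∈ flagTails I g := by
  obtain ⟨c, hce, hdesc, hc0⟩ := ht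
  refine ⟨fun k => if k = 0 then c 0 + s else c k, ?_, ?_, ?_⟩
  · have hne : I.e ≠ 0 := by omega
    simpa [hne] using hce
  · intro k hk1 hke
    by_cases hk : k = 1
    · subst hk
      show c 1 - (c 0 + s) ^ p ∈ _
      rw [add_pow_char]
      have h1 := hdesc 1 le_rfl hke
      rw [Nat.sub_self] at h1
      have : c 1 - (c 0 ^ p + s ^ p) = (c 1 - c 0 ^ p) - s ^ p := by ring
      rw [this]
      exact Submodule.sub_mem _ h1 hs
    · have hk0 : k ≠ 0 := by omega
      have hk0' : k - 1 ≠ 0 := by omega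
      simpa [hk0, hk0'] using hdesc k hk1 hke
  · show c 0 + s = t + s
    rw [hc0]

/-- [OURS · L1 W2.3] `TailTranslationClosed p` HOLDS for every prime `p`. [folklore] -/
theorem tailTranslationClosed_holds (p : ℕ) [Fact p.Prime] : TailTranslationClosed p :=
  fun _ _ _ _ I he _ _ _ ht hs => flagTails_add I he ht hs

/-- [OURS · L1 W2.3] Companion (converse direction at level `0`): two flag descents of the same bundle that agree at
level `1` have tails differing by a `p`-th root of a level-1 knock-out: `(c 0 − c' 0)^p ∈ ‖Σ_{a>0}(℘nega(Ě,−a) ∩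
I^{(p+1)}(Sing))‖`. With `flagTails_add`: given the levels `≥ 1`, the tail is determined EXACTLY up to such roots —
the flag's whole freedom at the bottom. [folklore] -/
theorem pow_sub_mem_of_flagDescent (I : InductionInput p O ℓ) (he : 1 ≤ I.e) {c c' : ℕ → O}
    (hdesc : FlagDescent I c) (hdesc' : FlagDescent I c') (h1 : c 1 = c' 1) :
    (c 0 - c' 0) ^ p ∈ forgetDegrees p O ℓ (I.negaSum 1) := by
  have h := hdesc 1 le_rfl he
  have h' := hdesc' 1 le_rfl he
  rw [Nat.sub_self] at h h'
  rw [sub_pow_char]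
  have : c 0 ^ p - c' 0 ^ p = (c' 1 - c' 0 ^ p) - (c 1 - c 0 ^ p) := by rw [h1]; ring
  rw [this]
  exact Submodule.sub_mem _ h' h

end General

/-- [OURS · L1 W2.3] `TailInMSquareTranslate p` HOLDS for every prime `p`: under the hypotheses of `TailInMSquare`,
`c 0 − (y + x^k t) = (c 0 − y) − x^k t ∈ max(O)²` for `x, t ∈ max(O)`, `k ≥ 1` (`tailInMSquare_holds`, p466324).
The `max²`-level statement cannot see the translation. [folklore] -/
theorem tailInMSquareTranslate_holds (p : ℕ) [Fact p.Prime] : TailInMSquareTranslate p := by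
  intro O _ _ _ ℓ I hI y ε hε c hce hdesc x t hx ht k hk
  have h := tailInMSquare_holds p O ℓ I hI y ε hε c hce hdesc
  have hxk : x ^ k ∈ maximalIdeal O := Ideal.pow_mem_of_mem _ hx k hk
  have hxt : x ^ k * t ∈ maximalIdeal O ^ 2 := by
    rw [pow_two]
    exact Ideal.mul_mem_mul hxk ht
  have : c 0 - (y + x ^ k * t) = (c 0 - y) - x ^ k * t := by ring
  rw [this]
  exact Ideal.sub_mem _ h hxt

/-! ## §B — the kangaroo point model (`p = 2`) -/

namespace K3

open MvPolynomial Literature.Barriers.ResolutionOfSingularities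
open Literature.AlgebraicGeometry.Resolution.Hauser2010

/-- `2 = 0` in `𝔽₂[x,y,z]`. [folklore] -/
theorem two_eq_zero : (2 : B) = 0 := CharTwo.two_eq_zero

/-- Explicit form: `F = z⁶(y⁵ + y⁴ + y³ + y²)` in `𝔽₂[x,y,z]`. [folklore] -/
theorem F_eq : F = X 2 ^ 6 * (X 1 ^ 5 + X 1 ^ 4 + X 1 ^ 3 + X 1 ^ 2) := by
  simp [F, kangarooResidual, rename_X, map_add, map_mul, map_pow]

/-- Explicit form: `s = z³y`. [folklore] -/
theorem s_eq : s = X 2 ^ 3 * X 1 := by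
  simp [s, kangarooGraph, rename_X, map_mul, map_pow]

/-- Explicit form of Hauser's re-chosen knock-out: `F + s² = z⁶(y⁵ + y⁴ + y³)` (the square `y²z⁶` is absorbed in
characteristic `2`; barrier file `kangarooResidual_add_sq`). [folklore] -/
theorem F_add_sq_eq : F + s ^ 2 = X 2 ^ 6 * (X 1 ^ 5 + X 1 ^ 4 + X 1 ^ 3) := by
  rw [F_eq, s_eq]
  linear_combination (X 1 ^ 2 * X 2 ^ 6 : B) * two_eq_zero

/-- A variable lies in `max_ξ = idealOfVars`. [folklore] -/
theorem X_mem (i : Fin 3) : (X i : B) ∈ idealOfVars (Fin 3) (ZMod 2) :=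
  Ideal.subset_span ⟨i, rfl⟩

/-- `X_i^n ∈ max_ξ^n`. [folklore] -/
theorem X_pow_mem (i : Fin 3) (n : ℕ) : (X i : B) ^ n ∈ idealOfVars (Fin 3) (ZMod 2) ^ n :=
  Ideal.pow_mem_pow (X_mem i) n

/-- `X_i^n ∈ max_ξ^m` for `m ≤ n`. [folklore] -/
theorem X_pow_mem_of_le (i : Fin 3) {m n : ℕ} (h : m ≤ n) : (X i : B) ^ n ∈ idealOfVars (Fin 3) (ZMod 2) ^ m :=
  Ideal.pow_le_pow_right h (X_pow_mem i n)

/-- `ord_ξ F ≥ 8`: `F ∈ max_ξ⁸`. [folklore] -/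
theorem F_mem_pow_eight : F ∈ idealOfVars (Fin 3) (ZMod 2) ^ 8 := by
  rw [F_eq, show (8 : ℕ) = 6 + 2 from rfl, pow_add]
  refine Ideal.mul_mem_mul (X_pow_mem 2 6) ?_
  refine Ideal.add_mem _ (Ideal.add_mem _ (Ideal.add_mem _ ?_ ?_) ?_) ?_
  · exact X_pow_mem_of_le 1 (by norm_num)
  · exact X_pow_mem_of_le 1 (by norm_num)
  · exact X_pow_mem_of_le 1 (by norm_num)
  · exact X_pow_mem 1 2

/-- In particular `F ∈ max_ξ³ = I^{(q+1)}(Sing)` of the point model (`q = 2`): the head descent's knock-out is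
admissible. [folklore] -/
theorem F_mem_pow_three : F ∈ idealOfVars (Fin 3) (ZMod 2) ^ 3 :=
  Ideal.pow_le_pow_right (by norm_num) F_mem_pow_eight

/-- `ord_ξ F = 8` exactly: `F ∉ max_ξ⁹` (the monomial `y²z⁶` has coefficient `1`, barrier file
`coeff_kangarooResidual_two_six`). [folklore] -/
theorem F_not_mem_pow_nine : F ∉ idealOfVars (Fin 3) (ZMod 2) ^ 9 := by
  intro h
  rw [mem_pow_idealOfVars_iff'] at h
  have hd : (Finsupp.single (1 : Fin 3) 2 + Finsupp.single 2 6).degree < 9 := by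
    rw [map_add, Finsupp.degree_single, Finsupp.degree_single]
    norm_num
  have hc := h _ hd
  have e : Finsupp.single (1 : Fin 3) 2 + Finsupp.single 2 6 =
      Finsupp.mapDomain Fin.succ (Finsupp.single (0 : Fin 2) 2 + Finsupp.single 1 6) := by
    rw [Finsupp.mapDomain_add, Finsupp.mapDomain_single, Finsupp.mapDomain_single]
    rfl
  rw [e, F, coeff_rename_mapDomain _ (Fin.succ_injective 2), coeff_kangarooResidual_two_six] at hc
  exact one_ne_zero hc

/-- `s = z³y ∈ max_ξ⁴`. [folklore] -/
theorem s_mem_pow_four : s ∈ idealOfVars (Fin 3) (ZMod 2) ^ 4 := by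
  rw [s_eq, show (4 : ℕ) = 3 + 1 from rfl, pow_add, pow_one]
  exact Ideal.mul_mem_mul (X_pow_mem 2 3) (X_mem 1)

/-- `s² ∈ max_ξ³` (indeed `max_ξ⁸`): the translation's knock-out contribution is admissible. [folklore] -/
theorem s_sq_mem_pow_three : s ^ 2 ∈ idealOfVars (Fin 3) (ZMod 2) ^ 3 := by
  have h8 : s ^ 2 ∈ idealOfVars (Fin 3) (ZMod 2) ^ 8 := by
    rw [show (8 : ℕ) = 4 * 2 from rfl, pow_mul]
    exact Ideal.pow_mem_pow s_mem_pow_four 2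
  exact Ideal.pow_le_pow_right (by norm_num) h8

/-- `ord_ξ(F + s²) ≥ 9`: Hauser's re-chosen knock-out lies in `max_ξ⁹`. [folklore] -/
theorem F_add_sq_mem_pow_nine : F + s ^ 2 ∈ idealOfVars (Fin 3) (ZMod 2) ^ 9 := by
  rw [F_add_sq_eq, show (9 : ℕ) = 6 + 3 from rfl, pow_add]
  refine Ideal.mul_mem_mul (X_pow_mem 2 6) ?_
  refine Ideal.add_mem _ (Ideal.add_mem _ ?_ ?_) ?_
  · exact X_pow_mem_of_le 1 (by norm_num)
  · exact X_pow_mem_of_le 1 (by norm_num)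
  · exact X_pow_mem 1 3

variable (ℓ : ℕ) (L1 : Submodule (iterateFrobenius B 2 ℓ).range B) (P : ℕ → Ideal B)

/-- [OURS · L1 W2.3] (1) The transported hypersurface `V³ = {x = 0}` is a flag tail of `g = x² + F³` in the point
model, for every `℘nega ∋ F³` in degree `−1` (head descent, p464759 `pointBundle_mem_flagTails`). [folklore] -/
theorem x_mem_flagTails (hF : F ∈ P 1) : (X 0 : B) ∈ flagTails (pointBundle ℓ L1 P) g :=
  pointBundle_mem_flagTails ℓ L1 P (g := g) (y := X 0) (ε := F) rfl hF F_mem_pow_three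

/-- The square of the translation is a level-1 knock-out of the point model (`s² ∈ ℘nega(Ě,−1) ∩ max_ξ³`).
[folklore] -/
theorem s_sq_mem_negaSum (hs : s ^ 2 ∈ P 1) :
    s ^ 2 ∈ forgetDegrees 2 B ℓ ((pointBundle ℓ L1 P).negaSum 1) :=
  mem_forgetDegrees_negaSum (pointBundle ℓ L1 P) 1 (a := 1) one_pos hs
    (by simpa [pointBundle, qSeq] using s_sq_mem_pow_three)

/-- [OURS · L1 W2.3] (2) Hauser's re-chosen `U³ = {x + yz³ = 0}` is a flag tail of `g` TOO — the translation
`x ↦ x + z³·y` («y ↦ y + x^k t») stays inside the class (`flagTails_add`). [folklore] -/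
theorem x_add_s_mem_flagTails (hF : F ∈ P 1) (hs : s ^ 2 ∈ P 1) :
    (X 0 + s : B) ∈ flagTails (pointBundle ℓ L1 P) g :=
  flagTails_add (pointBundle ℓ L1 P) (by simp [pointBundle]) (x_mem_flagTails ℓ L1 P hF)
    (s_sq_mem_negaSum ℓ L1 P hs)

/-- [OURS · L1 W2.3] (3) The two tails agree modulo `max_ξ⁴`. [folklore] -/
theorem tails_congr : (X 0 + s : B) - X 0 ∈ idealOfVars (Fin 3) (ZMod 2) ^ 4 := by
  rw [add_sub_cancel_left]
  exact s_mem_pow_four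

/-- [OURS · L1 W2.3] (4) The knock-out of the persistent tail `x` is the barrier's `F³ + 0²`, transported. [folklore] -/
theorem knockout_x : g - X 0 ^ 2 = rename Fin.succ (kangarooResidual (ZMod 2) + (0 : MvPolynomial (Fin 2) (ZMod 2)) ^ 2) := by
  rw [zero_pow two_ne_zero, add_zero]
  show X 0 ^ 2 + F - X 0 ^ 2 = F
  ring

/-- [OURS · L1 W2.3] (5) The knock-out of the re-chosen tail `x + yz³` is the barrier's `F³ + (yz³)²`, transported
(`(x + s)² = x² + s²` and `−s² = s²` in characteristic `2`). [folklore] -/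
theorem knockout_x_add_s :
    g - (X 0 + s) ^ 2 = rename Fin.succ (kangarooResidual (ZMod 2) + kangarooGraph (ZMod 2) ^ 2) := by
  rw [map_add, map_pow]
  show X 0 ^ 2 + F - (X 0 + s) ^ 2 = F + s ^ 2
  linear_combination (-(X 0 : B) * s - s ^ 2) * two_eq_zero

/-- Both tails also lie in the bottom `Θ(Ě,1)_ξ` of the flag (OURS reading `theta_ours 0`) as soon as the head
`g ∈ 𝔏(Ě,2)` (`flagTailMem`, p464759) — the §16.4 object itself contains `V³` and `U³`. [folklore] -/
theorem tails_mem_theta_ours_zero (hgL : g ∈ L1) (hF : F ∈ P 1) (hs : s ^ 2 ∈ P 1) :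
    (X 0 : B) ∈ (pointBundle ℓ L1 P).theta_ours 0 ∧ (X 0 + s : B) ∈ (pointBundle ℓ L1 P).theta_ours 0 := by
  constructor
  · obtain ⟨c, hce, hdesc, hc0⟩ := x_mem_flagTails ℓ L1 P hF
    have h := mem_theta_ours_of_flagDescent (pointBundle ℓ L1 P) (c := c)
      (by simpa [pointBundle] using hce.symm ▸ hgL) hdesc (k := 0) (by simp [pointBundle])
    rwa [hc0] at h
  · obtain ⟨c, hce, hdesc, hc0⟩ := x_add_s_mem_flagTails ℓ L1 P hF hs
    have h := mem_theta_ours_of_flagDescent (pointBundle ℓ L1 P) (c := c)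
      (by simpa [pointBundle] using hce.symm ▸ hgL) hdesc (k := 0) (by simp [pointBundle])
    rwa [hc0] at h

/-- … and in the AS-PRINTED bottom `theta 0` (equal to `theta_ours 0` at `e = 1`, p464759). [folklore] -/
theorem tails_mem_theta_zero (hgL : g ∈ L1) (hF : F ∈ P 1) (hs : s ^ 2 ∈ P 1) :
    (X 0 : B) ∈ (pointBundle ℓ L1 P).theta 0 ∧ (X 0 + s : B) ∈ (pointBundle ℓ L1 P).theta 0 := by
  rw [theta_zero_eq_theta_ours_zero _ rfl]
  exact tails_mem_theta_ours_zero ℓ L1 P hgL hF hs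

/-- RESIDUAL ORDER OF THE PERSISTENT TAIL, read off the barrier file at `K = 𝔽₂`: `ord₀(F³ + 0²) − |r'| = 8 − 6 = 2`
(`residualOrder_along_transform`; «`V³` no longer has weak maximal contact»). Instance of a tree theorem, not a
restatement. [folklore] -/
theorem residualOrder_persistent :
    ordZero (kangarooResidual (ZMod 2) + (0 : MvPolynomial (Fin 2) (ZMod 2)) ^ 2) - (kangarooMult.degree : ℕ∞) = 2 :=
  residualOrder_along_transform (ZMod 2)

/-- RESIDUAL ORDER OF THE RE-CHOSEN TAIL, read off the barrier file at `K = 𝔽₂`: `ord₀(F³ + (yz³)²) − |r'| = 9 − 6 = 3`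
(`ordZero_kangarooGraph`) `= shade_{a³}` (`graphShade_kangaroo`). Instance of tree theorems. [folklore] -/
theorem residualOrder_rechosen :
    ordZero (kangarooResidual (ZMod 2) + kangarooGraph (ZMod 2) ^ 2) - (kangarooMult.degree : ℕ∞) = 3 ∧
    graphShade (ZMod 2) 2 kangarooMult (kangarooResidual (ZMod 2)) = 3 := by
  refine ⟨?_, graphShade_kangaroo (ZMod 2)⟩
  rw [ordZero_kangarooGraph]
  simp [kangarooMult, Finsupp.degree_eq_sum]
  decide

/-- THE BARRIER IS MET, BY NAME: selecting the flag tail of maximal knock-out order at `a³` realises the shade `3`,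
which exceeds the shade `2` at the antelope point `a²` — conjunct of `Hauser2003_kangarooShadeIncrease` at `K = 𝔽₂`.
Instance of the tree theorem. [folklore] -/
theorem shade_jump :
    graphShade (ZMod 2) 2 antelopeMult (antelopeResidual (ZMod 2)) <
      graphShade (ZMod 2) 2 kangarooMult (kangarooResidual (ZMod 2)) :=
  (Hauser2003_kangarooShadeIncrease (ZMod 2)).2.2

/-- [OURS · L1 W2.3] hypothesis-free minimal instance (`𝔏(Ě,2) := ρ^ℓ(O)·g`, `℘nega := O`, the collapse reading of
GAP row R01): both tails are flag tails and lie in both typed bottoms of the flag. [folklore] -/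
theorem minimal (ℓ : ℕ) :
    (X 0 : B) ∈ flagTails (pointBundle ℓ (Submodule.span _ {g}) (fun _ => ⊤)) g ∧
    (X 0 + s : B) ∈ flagTails (pointBundle ℓ (Submodule.span _ {g}) (fun _ => ⊤)) g ∧
    (X 0 : B) ∈ (pointBundle ℓ (Submodule.span _ {g}) (fun _ => ⊤)).theta 0 ∧
    (X 0 + s : B) ∈ (pointBundle ℓ (Submodule.span _ {g}) (fun _ => ⊤)).theta 0 := by
  have hgL : g ∈ Submodule.span (iterateFrobenius B 2 ℓ).range {g} := Submodule.subset_span rfl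
  refine ⟨x_mem_flagTails ℓ _ _ trivial, x_add_s_mem_flagTails ℓ _ _ trivial trivial, ?_⟩
  exact tails_mem_theta_zero ℓ _ _ hgL trivial trivial

end K3

/-- [OURS · L1 W2.3] `KangarooPointTails ℓ` HOLDS for every depth `ℓ`. [folklore] -/
theorem kangarooPointTails_holds (ℓ : ℕ) : KangarooPointTails ℓ :=
  fun L1 P hF hs =>
    ⟨K3.x_mem_flagTails ℓ L1 P hF, K3.x_add_s_mem_flagTails ℓ L1 P hF hs, K3.tails_congr, K3.knockout_x,
      K3.knockout_x_add_s⟩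

/-- [OURS · L1 W2.3] `FlagDoesNotSelectOrder ℓ` HOLDS for every depth `ℓ`: the kangaroo point model with
`℘nega = O`, `𝔏(Ě,2) = ρ^ℓ(O)·g`, head `g = x² + F³`, tails `t₁ = x`, `t₂ = x + yz³`. [folklore] -/
theorem flagDoesNotSelectOrder_holds (ℓ : ℕ) : FlagDoesNotSelectOrder ℓ := by
  refine ⟨pointBundle ℓ (Submodule.span _ {K3.g}) (fun _ => ⊤), K3.g, MvPolynomial.X 0, MvPolynomial.X 0 + K3.s,
    (K3.minimal ℓ).1, (K3.minimal ℓ).2.1, K3.tails_congr, ?_, ?_⟩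
  · rw [K3.knockout_x, zero_pow two_ne_zero, add_zero]
    exact K3.F_not_mem_pow_nine
  · rw [K3.knockout_x_add_s, map_add, map_pow]
    exact K3.F_add_sq_mem_pow_nine

/-! ## §C — Th. 9.18 (2)-shaped corollary: with `ord y = 1` every flag tail is a regular parameter of the same
cotangent class (appended 2026-08-26 by the same seat; answers lane A's note on desk #10 «CotangentPoint is trivially
true for y ∈ 𝔪² — consumer binds ord y = 1») -/

section TailOrderOne

variable {p : ℕ} [Fact p.Prime] {O : Type u} [CommRing O] [IsRegularLocalRing O] [CharP O p] {ℓ : ℕ}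

/-- [OURS · L1 W2.3] replaces the role of Th. 9.18 (2) «y(e) mod max(O_ξ)² is a nonzero member of 𝔳(Ě)_ξ» (p.55 L37)
and of Eq. (84) (7) «ord g(e) = 1» (p.55) for tails obtained through the §16.4 flag; NOT a statement of the manuscript.
Under the hypotheses of `TailInMSquare` (regular local `O` of characteristic `p`, `I^{(m)}(Sing) ⊆ max(O)^m`, head
`y^{p^e} + ε` with `ord ε > p^e`, flag descent `c`) and with `ord y = 1` BOUND EXPLICITLY (`y ∈ max(O)`,
`y ∉ max(O)²`): the tail `c 0` lies in `max(O)` and not in `max(O)²` — it is a regular parameter with the same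
(non-zero) cotangent vector as `y`. (`flagDescent_sub_pow_mem`, p466324, at level `0`.) [folklore] -/
theorem tail_mem_and_not_mem_sq (I : InductionInput p O ℓ) (hI : ∀ m : ℕ, I.iSing m ≤ maximalIdeal O ^ m)
    {y ε : O} (hy1 : y ∈ maximalIdeal O) (hy2 : y ∉ maximalIdeal O ^ 2)
    (hε : ((p ^ I.e : ℕ) : ℕ∞) < adicOrder ε) {c : ℕ → O} (hce : c I.e = y ^ p ^ I.e + ε)
    (hdesc : FlagDescent I c) : c 0 ∈ maximalIdeal O ∧ c 0 ∉ maximalIdeal O ^ 2 := by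
  have hε' : ε ∈ maximalIdeal O ^ (p ^ I.e + 1) := by
    rw [← le_adicOrder_iff]
    have h := Order.add_one_le_of_lt hε
    exact_mod_cast h
  have h := flagDescent_sub_pow_mem I hI hε' hce hdesc (k := 0) (Nat.zero_le _)
  rw [pow_zero, pow_one] at h
  refine ⟨?_, fun hc => hy2 ?_⟩
  · have e1 : c 0 = (c 0 - y) + y := by ring
    rw [e1]
    exact Ideal.add_mem _ (Ideal.pow_le_self two_ne_zero h) hy1
  · have e2 : y = c 0 - (c 0 - y) := by ring
    rw [e2]
    exact Ideal.sub_mem _ hc h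

/-- [OURS · L1 W2.3] … equivalently `ord(c 0) = 1` (tree `adicOrder`): the flag tail has order exactly one, as
Eq. (84) (7) «ord g(e) = 1» requires of the printed tail; NOT a statement of the manuscript. [folklore] -/
theorem adicOrder_tail_eq_one (I : InductionInput p O ℓ) (hI : ∀ m : ℕ, I.iSing m ≤ maximalIdeal O ^ m)
    {y ε : O} (hy1 : y ∈ maximalIdeal O) (hy2 : y ∉ maximalIdeal O ^ 2)
    (hε : ((p ^ I.e : ℕ) : ℕ∞) < adicOrder ε) {c : ℕ → O} (hce : c I.e = y ^ p ^ I.e + ε)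
    (hdesc : FlagDescent I c) : adicOrder (c 0) = 1 := by
  obtain ⟨h1, h2⟩ := tail_mem_and_not_mem_sq I hI hy1 hy2 hε hce hdesc
  apply le_antisymm
  · have h := (adicOrder_le_iff (c 0) 1).mpr h2
    exact_mod_cast h
  · have h := (le_adicOrder_iff (c 0) 1).mpr (by rwa [pow_one])
    exact_mod_cast h

end TailOrderOne

end CampaignW23

end Summit.ResolutionOfSingularities.ResolutionOfSingularities.Theorems
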